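import Mathlib.LinearAlgebra.Dual.Lemmas
import Mathlib.LinearAlgebra.Dimension.Torsion.Finite
import Literature.NumberTheory.EllipticCurves.KatoRankBoundProofs
import HarnessLib

/-!
# BSD family — Kato's Selmer-corank bound from Thm 17.4 alone: `corank Sel_{p^∞}(E/K) ≤ rank_{ℤ_p} X/TX`

Second companion ("Proofs") file to `Literature.NumberTheory.EllipticCurves.KatoRankBound`, which
vendors K. Kato, *`p`-adic Hodge theory and values of zeta functions of modular forms*, Astérisque
295 (2004), Thm 18.4 (p. 281) as the named facts
`Literature.NumberTheory.EllipticCurves.kato_selmerCorank_le_order_padicLFunction`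
(`corank_{ℤ_p} Sel_{p^∞}(E/ℚ) ≤ ord_{T=0} L_p(E,T)`) and
`Literature.NumberTheory.EllipticCurves.kato_mordellWeilRank_le_order_padicLFunction`
(`rank E(ℚ) ≤ ord_{T=0} L_p(E,T)`) at an odd prime of good ordinary reduction. The first companion
file `KatoRankBoundProofs` reduced the Selmer-corank form to **two** deep named facts — Kato's
divisibility `kato_divisibility` (Kato Thm 17.4: `X(E/ℚ_∞)` is `Λ`-torsion and
`char_Λ X ∣ p^n L_p(E,T)`) and Mazur's control theorem in corank form
(`Greenberg1999_coinvariantsRank_eq_selmerCorank_rat`: `rank_{ℤ_p} X/TX = corank_{ℤ_p} Sel_{p^∞}(E/ℚ)`)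
— and the rank form to `kato_divisibility` alone (through `rank E(ℚ) ≤ rank_{ℤ_p} X/TX`,
`WeierstrassCurve.mordellWeilRank_le_coinvariantsRank`). This file removes the control theorem
from the Selmer-corank form as well:

* `WeierstrassCurve.selmerCorank_le_coinvariantsRank` (**proved**): for an elliptic curve `E/K`
  over a number field, *any* `ℤ_p`-extension `K_∞/K` with topological generator `γ` and any
  Pontryagin-dual datum `D` for `Sel_{p^∞}(E/K_∞)` with `X = D.X` finitely generated over
  `Λ = ℤ_p⟦T⟧`: `corank_{ℤ_p} Sel_{p^∞}(E/K) ≤ rank_{ℤ_p} X/TX`. This is the inequality half of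
  Greenberg's "`corank_{ℤ_p}(Sel_E(ℚ)_p)`, which is equal to `rank_{ℤ_p}(X/TX)`" (LNM 1716, §1,
  p. 65); it needs only Lemma 3.1 of loc. cit. (the restriction
  `θ : Sel_{p^∞}(E/K) → Sel_{p^∞}(E/K_∞)^Γ` has finite kernel; tree theorem
  `WeierstrassCurve.finite_subgroupResKer_kerSubgroup`) and Pontryagin duality, not the local
  analysis at `p` of the control theorem nor any finiteness of `Ш`.
* `kato_selmerCorank_le_order_padicLFunction_of_data'`,
  `kato_selmerCorank_le_order_padicLFunction_of_kato_divisibility` (**proved**): Kato Thm 18.4 in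
  Selmer-corank form from `kato_divisibility` (Thm 17.4) **alone**:
  `corank Sel ≤ rank X/TX ≤ ord_T g ≤ ord_T (ι g) = ord_T (p^n L_p) = ord_T L_p` for `g ∈ char_Λ X`
  (`Literature.NumberTheory.EllipticCurves.IwasawaAlgebra.coinvariantsRank_le_order_of_mem_charIdeal`),
  and `kato_rankBounds_of_kato_divisibility` (both forms; the rank form via the Kummer corank
  identity `WeierstrassCurve.selmerCorank_eq_mordellWeilRank_add_holds`, Kato's "In particular").

## The corank count (generic part, sub-namespace `ZpCorank`)

The tree measures the corank of a `p`-primary group `A` by the formula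
`Literature.NumberTheory.EllipticCurves.zpCorank A p = dim_{𝔽_p} A[p] − dim_{𝔽_p} A/pA` and the
`ℤ_p`-rank of `X/TX` by `finrank`. The bridge between the two is the elementary theorem
`ZpCorank.zpCorank_le_finrank_of_addEquiv_characterModule`: if `A` is `p`-primary, `π : A ↠ B` has
finite kernel and a finitely generated `ℤ_p`-module `N` is isomorphic *as a group* to
`Hom(B, ℚ/ℤ)`, then `zpCorank A p ≤ rank_{ℤ_p} N`. Ingredients, all proved here:

1. `ZpCorank.natCard_characterModule`: `#Hom(V, ℚ/ℤ) = #V` for a finite `𝔽_p`-vector space `V`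
   (characters correspond to `𝔽_p`-linear functionals through the basic character
   `ℤ/p → ℚ/ℤ`, `k ↦ k/p`, whose image is `(ℚ/ℤ)[p]`; then `dim V^* = dim V`, Mathlib
   `Subspace.dual_finrank_eq`).
2. `ZpCorank.natCard_characterModule_torsionBy_le`, `ZpCorank.natCard_torsionBy_characterModule_le`:
   `Hom(B, ℚ/ℤ)/p ↠ Hom(B[p], ℚ/ℤ)` (injectivity of `ℚ/ℤ`) and `Hom(B, ℚ/ℤ)[p] ↪ Hom(B/pB, ℚ/ℤ)`.
3. `ZpCorank.natCard_modN_le`: `#(N/pN) ≤ p^{rank N} · #N[p]` for a finitely generated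
   `ℤ_p`-module `N` (torsion submodule finite, `N/N_tors` free of rank `rank N`).
4. `ZpCorank.zpCorank_le_of_surjective` (Herbrand-type inequality): `zpCorank A p ≤ zpCorank B p`
   for a surjection `A ↠ B` with finite kernel, by index calculus (no snake lemma).

## The Selmer argument (`WeierstrassCurve.selmerCorank_le_coinvariantsRank`)

With `θ : Sel_{p^∞}(E/K) → Sel_{p^∞}(E/K_∞)` the restriction (`resInfty` corestricted by
`resInfty_mem_selmerInfty`; finite kernel by Lemma 3.1, `finite_subgroupResKer_kerSubgroup`), the
restriction of characters `x ↦ (toDual x)|_{θ(Sel)}` kills `TX` (restricted classes are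
`conj_γ`-invariant, `conjH1_resInfty`, `toDual_T_smul`) and so descends to
`R : X/TX → Hom(θ(Sel), ℚ/ℤ)`; its kernel is a `ℤ_p`-submodule (`toDual_C_smul`) and
`(X/TX)/ker R ≅ Hom(θ(Sel), ℚ/ℤ)` (every character of `θ(Sel) ⊆ Sel_∞` extends). Hence
`corank Sel_{p^∞}(E/K) ≤ rank (X/TX)/ker R ≤ rank X/TX`. All auxiliary maps are local to the proof;
the file declares theorems only (no new definitions, no new named facts), and no statement of
`KatoRankBound`/`KatoRankBoundProofs` is touched. The `ℤ_p`-module structure on `X/TX` is the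
restriction of scalars `Module.compHom` of `coinvariantsRank_eq_finrank_int` (a `letI`, as there).

## References

* K. Kato, *`p`-adic Hodge theory and values of zeta functions of modular forms*, Astérisque 295
  (2004), 117–290 (held copy `paper:doi-10-24033-ast-639`): Thm 17.4 (PDF p. 158 = p. 273),
  §18, Thm 18.4 (PDF p. 166 = p. 281).
* R. Greenberg, *Iwasawa theory for elliptic curves*, in: Arithmetic Theory of Elliptic Curves
  (Cetraro 1997), LNM 1716, Springer (1999), 51–144: §1 pp. 60, 65 (coranks, `X/TX`), Thm 1.2,
  §3 Lemma 3.1 (p. 86).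
* B. Mazur, *Rational points of abelian varieties with values in towers of number fields*,
  Invent. Math. 18 (1972), 183–266, §6.
* J.-P. Serre, *Galois Cohomology*, I.§2.2 (cocycles of compact groups in discrete modules).
-/

noncomputable section

open scoped Classical AddSubgroup

universe u

namespace Literature.NumberTheory.EllipticCurves

namespace ZpCorank

section ElementaryDual

variable (p : ℕ) [hp : Fact p.Prime]

/-- **`#Hom(V, ℚ/ℤ) = #V` for a finite `𝔽_p`-vector space `V`.** Characters of a `ZMod p`-module
correspond bijectively to `𝔽_p`-linear functionals, `f ↦ ι ∘ f`, through the basic character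
`ι : ℤ/p → ℚ/ℤ = AddCircle (1 : ℚ)`, `k ↦ k/p` (injective since `1/p` has order `p`, Mathlib
`AddCircle.addOrderOf_period_div`; every character of `V` takes values in `(ℚ/ℤ)[p] = im ι`), and
`dim V^* = dim V` (Mathlib `Subspace.dual_finrank_eq`). [folklore] -/
theorem natCard_characterModule (V : Type*) [AddCommGroup V] [Module (ZMod p) V] [Finite V] :
    Nat.card (CharacterModule V) = Nat.card V := by
  -- the basic character `ι : ℤ/p → ℚ/ℤ`, `k ↦ k/p`
  have horder : addOrderOf ((((1 : ℚ) / p : ℚ)) : AddCircle (1 : ℚ)) = p := by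
    haveI : Fact ((0 : ℚ) < 1) := ⟨one_pos⟩
    exact AddCircle.addOrderOf_period_div hp.out.pos
  let ι : ZMod p →+ AddCircle (1 : ℚ) :=
    ZMod.lift p ⟨zmultiplesHom (AddCircle (1 : ℚ)) (((1 : ℚ) / p : ℚ) : AddCircle (1 : ℚ)), by
      simp only [zmultiplesHom_apply]
      exact addOrderOf_dvd_iff_zsmul_eq_zero.mp (by rw [horder])⟩
  have hι : ∀ k : ℤ, ι (k : ZMod p) = k • ((((1 : ℚ) / p : ℚ)) : AddCircle (1 : ℚ)) := fun k ↦ by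
    simp [ι]
  have hιinj : Function.Injective ι := by
    rw [injective_iff_map_eq_zero]
    intro k hk
    obtain ⟨m, rfl⟩ := ZMod.intCast_surjective k
    rw [hι] at hk
    have hdvd : (p : ℤ) ∣ m := by
      have h := addOrderOf_dvd_iff_zsmul_eq_zero.mpr hk
      rwa [horder] at h
    exact (ZMod.intCast_zmod_eq_zero_iff_dvd m p).mpr hdvd
  -- its image is `(ℚ/ℤ)[p]`
  have hιrange : ∀ x : AddCircle (1 : ℚ), p • x = 0 → x ∈ ι.range := by
    intro x hx
    induction x using QuotientAddGroup.induction_on with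
    | H q =>
      have hq : ((p • q : ℚ) : AddCircle (1 : ℚ)) = 0 := by
        rw [QuotientAddGroup.mk_nsmul]; exact hx
      rw [QuotientAddGroup.eq_zero_iff, AddSubgroup.mem_zmultiples_iff] at hq
      obtain ⟨m, hm⟩ := hq
      refine ⟨(m : ZMod p), ?_⟩
      rw [hι]
      have hq' : q = m • ((1 : ℚ) / p) := by
        have hp0 : (p : ℚ) ≠ 0 := by exact_mod_cast hp.out.ne_zero
        rw [zsmul_eq_mul, mul_one, nsmul_eq_mul] at hm
        rw [zsmul_eq_mul, hm]
        field_simp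
      rw [hq', ← QuotientAddGroup.mk_zsmul]
  -- characters of `V` are `p`-torsion valued
  have hval : ∀ (χ : CharacterModule V) (v : V), p • χ v = 0 := fun χ v ↦ by
    rw [← map_nsmul, ← Nat.cast_smul_eq_nsmul (ZMod p), ZMod.natCast_self, zero_smul, map_zero]
  -- `f ↦ ι ∘ f` is a bijection `V^* → Hom(V, ℚ/ℤ)`
  let Φ : Module.Dual (ZMod p) V → CharacterModule V := fun f ↦ ι.comp f.toAddMonoidHom
  have hΦ : ∀ f v, Φ f v = ι (f v) := fun _ _ ↦ rfl
  have hΦbij : Function.Bijective Φ := by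
    constructor
    · intro f g hfg
      ext v
      have h := DFunLike.congr_fun hfg v
      rw [hΦ, hΦ] at h
      exact hιinj h
    · intro χ
      have hmem : ∀ v, χ v ∈ ι.range := fun v ↦ hιrange _ (hval χ v)
      choose g hg using hmem
      have hg_add : ∀ v w, g (v + w) = g v + g w := fun v w ↦ hιinj (by
        rw [map_add, hg, hg, hg, map_add])
      let g' : V →+ ZMod p :=
        { toFun := g
          map_zero' := hιinj (by rw [hg, map_zero, map_zero])
          map_add' := hg_add }
      refine ⟨g'.toZModLinearMap p, ?_⟩
      ext v
      rw [hΦ]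
      exact hg v
  haveI : Module.Finite (ZMod p) V := Module.Finite.of_finite
  rw [← Nat.card_eq_of_bijective _ hΦbij,
    Module.natCard_eq_pow_finrank (K := ZMod p) (V := Module.Dual (ZMod p) V),
    Subspace.dual_finrank_eq, ← Module.natCard_eq_pow_finrank (K := ZMod p)]

/-- The character group of a finite `ZMod p`-module is finite. [folklore] -/
theorem finite_characterModule (V : Type*) [AddCommGroup V] [Module (ZMod p) V] [Finite V] :
    Finite (CharacterModule V) := by
  have h := natCard_characterModule p V
  haveI : Nonempty V := ⟨0⟩
  exact Nat.finite_of_card_ne_zero (h ▸ Nat.card_pos.ne')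

end ElementaryDual



section DualPieces

variable (p : ℕ) (B : Type*) [AddCommGroup B]

/-- `ModN.mkQ n x = 0 ↔ x ∈ nG`. [folklore] -/
theorem modN_mkQ_eq_zero_iff {G : Type*} [AddCommGroup G] (n : ℕ) (x : G) :
    ModN.mkQ n x = 0 ↔ x ∈ LinearMap.range (LinearMap.lsmul ℤ G n) :=
  Submodule.Quotient.mk_eq_zero _

/-- **`#Hom(B[p], ℚ/ℤ) ≤ #(Hom(B, ℚ/ℤ)/p)`**: the restriction `Hom(B, ℚ/ℤ) → Hom(B[p], ℚ/ℤ)` is onto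
(characters of a subgroup extend: `ℚ/ℤ` is injective, Mathlib
`CharacterModule.dual_surjective_of_injective`) and kills `p · Hom(B, ℚ/ℤ)`. [folklore] -/
theorem natCard_characterModule_torsionBy_le [Finite (ModN (CharacterModule B) p)] :
    Nat.card (CharacterModule (B[(p : ℤ)])) ≤ Nat.card (ModN (CharacterModule B) p) := by
  let r : ModN (CharacterModule B) p →+ CharacterModule (B[(p : ℤ)]) :=
    ModN.liftEquiv.symm
      ⟨(CharacterModule.dual ((B[(p : ℤ)]).subtype.toIntLinearMap)).toAddMonoidHom, fun χ ↦ by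
        refine AddMonoidHom.ext fun b ↦ ?_
        show p • χ (b : B) = 0
        rw [← map_nsmul, ← AddSubgroupClass.coe_nsmul, AddSubgroup.torsionBy.nsmul b,
          ZeroMemClass.coe_zero, map_zero]⟩
  have hr : ∀ (χ : CharacterModule B) (b : B[(p : ℤ)]), r (ModN.mkQ p χ) b = χ b := fun _ _ ↦ rfl
  refine Nat.card_le_card_of_surjective r fun ψ ↦ ?_
  obtain ⟨χ, hχ⟩ := CharacterModule.dual_surjective_of_injective
    ((B[(p : ℤ)]).subtype.toIntLinearMap) (fun a b h ↦ Subtype.ext h) ψ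
  refine ⟨ModN.mkQ p χ, CharacterModule.ext (A := B[(p : ℤ)]) fun b ↦ ?_⟩
  rw [hr, ← hχ]
  rfl

/-- **`#(Hom(B, ℚ/ℤ)[p]) ≤ #Hom(B/pB, ℚ/ℤ)`**: a `p`-torsion character of `B` factors through `B/pB`,
injectively. [folklore] -/
theorem natCard_torsionBy_characterModule_le [Finite (CharacterModule (ModN B p))] :
    Nat.card ((CharacterModule B)[(p : ℤ)]) ≤ Nat.card (CharacterModule (ModN B p)) := by
  let t : (CharacterModule B)[(p : ℤ)] → CharacterModule (ModN B p) := fun χ ↦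
    ModN.liftEquiv.symm ⟨(χ : CharacterModule B), fun g ↦ by
      have h : p • χ = 0 := AddSubgroup.torsionBy.nsmul χ
      exact DFunLike.congr_fun (congrArg Subtype.val h) g⟩
  have ht : ∀ (χ : (CharacterModule B)[(p : ℤ)]) (b : B),
      t χ (ModN.mkQ p b) = (χ : CharacterModule B) b := fun _ _ ↦ rfl
  refine Nat.card_le_card_of_injective t fun χ χ' h ↦ ?_
  apply Subtype.ext
  refine CharacterModule.ext (A := B) fun b ↦ ?_
  rw [← ht, ← ht, h]

end DualPieces

section ZpModule

variable (p : ℕ) [hp : Fact p.Prime] (N : Type*) [AddCommGroup N] [Module ℤ_[p] N]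
  [Module.Finite ℤ_[p] N]

/-- The torsion submodule of a finitely generated `ℤ_p`-module is killed by a power of `p`. [folklore] -/
theorem exists_pow_smul_torsion_eq_zero :
    ∃ m : ℕ, ∀ t ∈ Submodule.torsion ℤ_[p] N, ((p : ℤ_[p]) ^ m) • t = 0 := by
  set T := Submodule.torsion ℤ_[p] N
  obtain ⟨c, hc, hc0⟩ := Submodule.annihilator_top_inter_nonZeroDivisors (R := ℤ_[p]) (M := T)
    (Submodule.torsion_isTorsion)
  have hc0' : (c : ℤ_[p]) ≠ 0 := nonZeroDivisors.ne_zero hc0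
  refine ⟨c.valuation, fun t ht ↦ ?_⟩
  have h1 : c • (⟨t, ht⟩ : T) = 0 := Submodule.mem_annihilator.mp hc _ Submodule.mem_top
  have h2 : c • t = 0 := by simpa using congrArg Subtype.val h1
  set u := PadicInt.unitCoeff hc0'
  have h3 : (p : ℤ_[p]) ^ c.valuation • t =
      ((u⁻¹ : ℤ_[p]ˣ) : ℤ_[p]) • (((u : ℤ_[p]) * (p : ℤ_[p]) ^ c.valuation) • t) := by
    rw [← mul_smul, ← mul_assoc, Units.inv_mul, one_mul]
  rw [h3, ← PadicInt.unitCoeff_spec hc0', h2, smul_zero]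

/-- The torsion submodule of a finitely generated `ℤ_p`-module is finite. [folklore] -/
theorem finite_torsion : Finite (Submodule.torsion ℤ_[p] N) := by
  obtain ⟨m, hm⟩ := exists_pow_smul_torsion_eq_zero p N
  set T := Submodule.torsion ℤ_[p] N
  obtain ⟨k, s, hs⟩ := Module.Finite.exists_fin (R := ℤ_[p]) (M := T)
  let g : (Fin k → ZMod (p ^ m)) → T := fun v ↦ ∑ i, ((v i).val : ℤ_[p]) • s i
  refine Finite.of_surjective g fun t ↦ ?_
  have ht : t ∈ Submodule.span ℤ_[p] (Set.range s) := by rw [hs]; trivial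
  obtain ⟨c, rfl⟩ := (Submodule.mem_span_range_iff_exists_fun ℤ_[p]).mp ht
  refine ⟨fun i ↦ PadicInt.toZModPow m (c i), Finset.sum_congr rfl fun i _ ↦ ?_⟩
  have hdiff : c i - ((PadicInt.toZModPow m (c i)).val : ℤ_[p]) ∈ Ideal.span {(p : ℤ_[p]) ^ m} := by
    rw [← PadicInt.ker_toZModPow, RingHom.mem_ker, map_sub, map_natCast, ZMod.natCast_zmod_val,
      sub_self]
  obtain ⟨a, ha⟩ := Ideal.mem_span_singleton'.mp hdiff
  have hpm : ((p : ℤ_[p]) ^ m) • s i = 0 := by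
    apply Subtype.ext
    rw [Submodule.coe_smul, Submodule.coe_zero]
    exact hm _ (s i).2
  have h0 : (c i - ((PadicInt.toZModPow m (c i)).val : ℤ_[p])) • s i = 0 := by
    rw [← ha, mul_smul, hpm, smul_zero]
  rw [sub_smul, sub_eq_zero] at h0
  exact h0.symm

/-- `#((ℤ_p^ι)/p) = p ^ #ι`. [folklore] -/
theorem natCard_modN_pi (ι : Type*) [Fintype ι] :
    Nat.card (ModN (ι → ℤ_[p]) p) = p ^ Fintype.card ι := by
  let φ : (ι → ℤ_[p]) →+ (ι → ZMod p) :=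
    AddMonoidHom.pi fun i ↦ (PadicInt.toZMod (p := p)).toAddMonoidHom.comp
      (Pi.evalAddMonoidHom (fun _ ↦ ℤ_[p]) i)
  have hφ : ∀ w i, φ w i = PadicInt.toZMod (w i) := fun _ _ ↦ rfl
  have hsurj : Function.Surjective φ := by
    intro v
    refine ⟨fun i ↦ ((v i).val : ℤ_[p]), funext fun i ↦ ?_⟩
    rw [hφ, map_natCast, ZMod.natCast_zmod_val]
  have hker : φ.ker = (LinearMap.range (LinearMap.lsmul ℤ (ι → ℤ_[p]) p)).toAddSubgroup := by
    ext w
    simp only [AddMonoidHom.mem_ker, Submodule.mem_toAddSubgroup, LinearMap.mem_range,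
      LinearMap.lsmul_apply]
    constructor
    · intro hw
      have hw' : ∀ i, ∃ a : ℤ_[p], a * p = w i := fun i ↦ by
        have hi : PadicInt.toZMod (w i) = 0 := by rw [← hφ, hw]; rfl
        rw [← RingHom.mem_ker, PadicInt.ker_toZMod, PadicInt.maximalIdeal_eq_span_p] at hi
        exact Ideal.mem_span_singleton'.mp hi
      choose a ha using hw'
      refine ⟨a, funext fun i ↦ ?_⟩
      rw [Pi.smul_apply, ← ha i, zsmul_eq_mul, Int.cast_natCast, mul_comm]
    · rintro ⟨y, rfl⟩
      funext i
      rw [hφ, Pi.smul_apply, zsmul_eq_mul, Int.cast_natCast, map_mul, map_natCast, ZMod.natCast_self,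
        zero_mul]
      rfl
  have e : ModN (ι → ℤ_[p]) p ≃+ (ι → ZMod p) :=
    (QuotientAddGroup.quotientAddEquivOfEq hker.symm).trans
      (QuotientAddGroup.quotientKerEquivOfSurjective φ hsurj)
  rw [Nat.card_congr e.toEquiv, Nat.card_fun, Nat.card_zmod, Nat.card_eq_fintype_card]

/-- `#(L/pL) = p ^ rank L` for a finite free `ℤ_p`-module `L`. [folklore] -/
theorem natCard_modN_of_free (L : Type*) [AddCommGroup L] [Module ℤ_[p] L] [Module.Finite ℤ_[p] L]
    [Module.Free ℤ_[p] L] : Nat.card (ModN L p) = p ^ Module.finrank ℤ_[p] L := by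
  let e : L ≃ₗ[ℤ_[p]] (Fin (Module.finrank ℤ_[p] L) → ℤ_[p]) := (Module.finBasis ℤ_[p] L).equivFun
  rw [Nat.card_congr (modNEquiv e.toAddEquiv p).toEquiv, natCard_modN_pi, Fintype.card_fin]

/-- The `p`-torsion of a finitely generated `ℤ_p`-module is finite (it lies in the torsion
submodule). [folklore] -/
theorem finite_torsionBy : Finite N[(p : ℤ)] := by
  haveI := finite_torsion p N
  refine Finite.of_injective (fun x : N[(p : ℤ)] ↦ (⟨(x : N), ?_⟩ : Submodule.torsion ℤ_[p] N)) ?_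
  · rw [Submodule.mem_torsion_iff]
    refine ⟨⟨(p : ℤ_[p]), mem_nonZeroDivisors_of_ne_zero (by exact_mod_cast hp.out.ne_zero)⟩, ?_⟩
    show (p : ℤ_[p]) • (x : N) = 0
    rw [Nat.cast_smul_eq_nsmul, ← natCast_zsmul]
    exact x.2
  · intro x y hxy
    exact Subtype.ext (by simpa using congrArg Subtype.val hxy)

/-- **`#(N/pN) ≤ p ^ rank N · #N[p]`** for a finitely generated `ℤ_p`-module `N` (with `N/pN`
finite): `N/pN ↠ L/pL` for the free quotient `L = N/N_tors` of rank `rank N`, with kernel the image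
of the finite group `N_tors`, of order `≤ #N[p]`. (Equality holds: `N ≅ ℤ_p^ρ ⊕ N_tors`.) [folklore] -/
theorem natCard_modN_le :
    Finite (ModN N p) ∧ Nat.card (ModN N p) ≤ p ^ Module.finrank ℤ_[p] N * Nat.card N[(p : ℤ)] := by
  set T := Submodule.torsion ℤ_[p] N with hT
  haveI : Finite T := finite_torsion p N
  haveI : Finite N[(p : ℤ)] := finite_torsionBy p N
  let L := N ⧸ T
  have hrank : Module.finrank ℤ_[p] L = Module.finrank ℤ_[p] N :=
    finrank_quotient_eq_of_le_torsion (le_refl _)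
  -- the induced map `N/pN → L/pL`
  have hle : (LinearMap.range (LinearMap.lsmul ℤ N p)).toAddSubgroup ≤
      ((LinearMap.range (LinearMap.lsmul ℤ L p)).toAddSubgroup).comap T.mkQ.toAddMonoidHom := by
    rintro _ ⟨y, rfl⟩
    refine ⟨T.mkQ y, ?_⟩
    simp only [LinearMap.lsmul_apply, LinearMap.toAddMonoidHom_coe, map_zsmul]
  let π : ModN N p →+ ModN L p := QuotientAddGroup.map _ _ T.mkQ.toAddMonoidHom hle
  have hπ : ∀ n : N, π (ModN.mkQ p n) = ModN.mkQ p (T.mkQ n) := fun _ ↦ rfl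
  have hπsurj : Function.Surjective π := by
    intro q
    induction q using QuotientAddGroup.induction_on with
    | H ℓ =>
      obtain ⟨n, rfl⟩ := T.mkQ_surjective ℓ
      exact ⟨ModN.mkQ p n, hπ n⟩
  -- its kernel is the image of `T`
  let ψ := (ModN.mkQ p).comp T.toAddSubgroup.subtype
  have hker : π.ker ≤ ψ.range := by
    intro q hq
    induction q using QuotientAddGroup.induction_on with
    | H n =>
      rw [AddMonoidHom.mem_ker] at hq
      change ModN.mkQ p (T.mkQ n) = 0 at hq
      have hq' : T.mkQ n ∈ LinearMap.range (LinearMap.lsmul ℤ L p) := by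
        rwa [modN_mkQ_eq_zero_iff] at hq
      obtain ⟨ℓ, hℓ⟩ := hq'
      obtain ⟨n', rfl⟩ := T.mkQ_surjective ℓ
      rw [LinearMap.lsmul_apply, ← map_zsmul, ← sub_eq_zero, ← map_sub, Submodule.mkQ_apply,
        Submodule.Quotient.mk_eq_zero] at hℓ
      have e : (QuotientAddGroup.mk n : ModN N p) =
          ψ ⟨-( (p : ℤ) • n' - n), T.neg_mem hℓ⟩ + ModN.mkQ p ((p : ℤ) • n') := by
        change ModN.mkQ p n = ModN.mkQ p (-( (p : ℤ) • n' - n)) + ModN.mkQ p ((p : ℤ) • n')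
        rw [← map_add]
        congr 1
        abel
      rw [e]
      refine add_mem ⟨_, rfl⟩ ?_
      have h0 : ModN.mkQ p ((p : ℤ) • n') = 0 := by
        rw [modN_mkQ_eq_zero_iff]
        exact ⟨n', rfl⟩
      rw [h0]
      exact zero_mem _
  haveI : Finite ψ.range := Finite.of_surjective _ ψ.rangeRestrict_surjective
  have hinj : Function.Injective (fun x : π.ker ↦ (⟨x.1, hker x.2⟩ : ψ.range)) :=
    fun x y hxy ↦ Subtype.ext (by simpa using congrArg Subtype.val hxy)
  haveI : Finite π.ker := Finite.of_injective _ hinj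
  have hcardker : Nat.card π.ker ≤ Nat.card N[(p : ℤ)] :=
    (Nat.card_le_card_of_injective _ hinj).trans
      (natCard_range_mkQ_comp_subtype_le T.toAddSubgroup)
  have hcard : Nat.card (ModN N p) = Nat.card (ModN L p) * Nat.card π.ker := by
    rw [AddSubgroup.card_eq_card_quotient_mul_card_addSubgroup π.ker,
      Nat.card_congr (QuotientAddGroup.quotientKerEquivOfSurjective π hπsurj).toEquiv]
  have hL : Nat.card (ModN L p) = p ^ Module.finrank ℤ_[p] N := by
    rw [natCard_modN_of_free, hrank]
  refine ⟨?_, ?_⟩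
  · refine Nat.finite_of_card_ne_zero ?_
    rw [hcard, hL]
    exact mul_ne_zero (pow_ne_zero _ hp.out.ne_zero) Nat.card_pos.ne'
  · rw [hcard, hL]
    exact Nat.mul_le_mul_left _ hcardker

end ZpModule


section Herbrand

variable {p : ℕ} [hp : Fact p.Prime] {A : Type*} [AddCommGroup A]

/-- Junk case of the corank formula: if `A[p]` is infinite then `zpCorank A p = 0`
(`finrank` vanishes in infinite dimension). [folklore] -/
theorem zpCorank_eq_zero_of_not_finite (h : ¬ Finite A[(p : ℤ)]) : zpCorank A p = 0 := by
  unfold zpCorank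
  letI : Module (ZMod p) A[(p : ℤ)] := AddSubgroup.torsionBy.zmodModule
  have h0 : Module.finrank (ZMod p) A[(p : ℤ)] = 0 :=
    Module.finrank_of_not_finite fun _ ↦ h (Module.finite_of_finite (ZMod p))
  rw [h0, Nat.zero_sub]

omit hp in
/-- A quotient of a `p`-primary group is `p`-primary. [folklore] -/
theorem primary_of_surjective (hA : ∀ a : A, ∃ n : ℕ, p ^ n • a = 0) {B : Type*} [AddCommGroup B]
    (π : A →+ B) (hπ : Function.Surjective π) : ∀ b : B, ∃ n : ℕ, p ^ n • b = 0 := by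
  intro b
  obtain ⟨a, rfl⟩ := hπ b
  obtain ⟨n, hn⟩ := hA a
  exact ⟨n, by rw [← map_nsmul, hn, map_zero]⟩

/-- **Herbrand-type inequality for the corank formula.** For a `p`-primary abelian group `A` and a
surjection `π : A → B` with finite kernel `F`, `zpCorank A p ≤ zpCorank B p` (in fact equality: the
quotient `#(·)[p] / #(·/p)` is insensitive to finite subquotients). Proof by index calculus: with
`A_F = π⁻¹(B[p]) = {a | p a ∈ F}` one has `#A_F = #B[p] · #F = #A[p] · #(p A_F)`,
`#(A/pA) = #(B/pB) · #im(F → A/pA)`, `#F = #ker(F → A/pA) · #im(F → A/pA)` and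
`ker(F → A/pA) = F ∩ pA ⊆ p A_F`; hence `#A[p] · #(B/pB) ≤ #B[p] · #(A/pA)`.
Greenberg (1999), §1 (coranks of "cofinitely generated" groups ignore finite groups). [folklore] -/
theorem zpCorank_le_of_surjective (hA : ∀ a : A, ∃ n : ℕ, p ^ n • a = 0) {B : Type*}
    [AddCommGroup B] (π : A →+ B) (hπs : Function.Surjective π) [Finite π.ker] :
    zpCorank A p ≤ zpCorank B p := by
  by_cases hfin : Finite A[(p : ℤ)]
  swap
  · rw [zpCorank_eq_zero_of_not_finite hfin]; exact Nat.zero_le _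
  haveI := hfin
  set F := π.ker with hFdef
  have hB : ∀ b : B, ∃ n : ℕ, p ^ n • b = 0 := primary_of_surjective hA π hπs
  obtain ⟨hAmod, -⟩ := finite_modN_of_primary hA
  haveI := hAmod
  let AF : AddSubgroup A := (B[(p : ℤ)]).comap π
  have hAF : ∀ a, a ∈ AF ↔ p • a ∈ F := fun a ↦ by
    rw [AddSubgroup.mem_comap, AddSubgroup.torsionBy.nsmul_iff, ← map_nsmul, hFdef,
      AddMonoidHom.mem_ker]
  have hF_le : F ≤ AF := fun f hf ↦ (hAF f).mpr (F.nsmul_mem hf p)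
  have hAp_le : A[(p : ℤ)] ≤ AF := fun a ha ↦ (hAF a).mpr (by
    rw [AddSubgroup.torsionBy.nsmul_iff.mp ha]; exact F.zero_mem)
  -- `[p] : A_F → A`, kernel `A[p]`, image `p A_F ⊆ F`
  let mp : AF →+ A := (nsmulAddMonoidHom p).comp AF.subtype
  have hmp : ∀ a : AF, mp a = p • (a : A) := fun _ ↦ rfl
  have hker_mp : mp.ker = (A[(p : ℤ)]).addSubgroupOf AF := by
    ext a
    rw [AddMonoidHom.mem_ker, AddSubgroup.mem_addSubgroupOf, hmp, AddSubgroup.torsionBy.nsmul_iff]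
  have hfinrange : Finite mp.range := by
    refine Finite.of_injective (fun x : mp.range ↦ (⟨x.1, ?_⟩ : F)) ?_
    · obtain ⟨a, ha⟩ := x.2
      rw [← ha, hmp]
      exact (hAF a).mp a.2
    · intro x y hxy
      exact Subtype.ext (by simpa using congrArg Subtype.val hxy)
  haveI := hfinrange
  haveI : Finite mp.ker := by
    rw [hker_mp]
    exact Finite.of_equiv _ (AddSubgroup.addSubgroupOfEquivOfLe hAp_le).symm.toEquiv
  haveI : Finite (AF ⧸ mp.ker) :=
    Finite.of_equiv _ (QuotientAddGroup.quotientKerEquivRange mp).symm.toEquiv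
  haveI : Finite AF := Finite.of_addSubgroup_quotient mp.ker
  -- `A_F → B[p]` is onto with kernel `F`
  let πF : AF →+ B[(p : ℤ)] := (π.comp AF.subtype).codRestrict _ (fun a ↦ a.2)
  have hπF_surj : Function.Surjective πF := by
    rintro ⟨b, hb⟩
    obtain ⟨a, rfl⟩ := hπs b
    exact ⟨⟨a, hb⟩, rfl⟩
  haveI : Finite B[(p : ℤ)] := Finite.of_surjective _ hπF_surj
  obtain ⟨hBmod, -⟩ := finite_modN_of_primary hB
  haveI := hBmod
  have hker_πF : πF.ker = F.addSubgroupOf AF := by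
    ext a
    rw [AddMonoidHom.mem_ker, AddSubgroup.mem_addSubgroupOf, hFdef, AddMonoidHom.mem_ker]
    constructor
    · intro h
      exact congrArg Subtype.val h
    · intro h
      exact Subtype.ext h
  have ha : Nat.card AF = Nat.card B[(p : ℤ)] * Nat.card F := by
    rw [AddSubgroup.card_eq_card_quotient_mul_card_addSubgroup πF.ker,
      Nat.card_congr (QuotientAddGroup.quotientKerEquivOfSurjective πF hπF_surj).toEquiv, hker_πF,
      Nat.card_congr (AddSubgroup.addSubgroupOfEquivOfLe hF_le).toEquiv]
  have hb : Nat.card AF = Nat.card mp.range * Nat.card A[(p : ℤ)] := by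
    rw [AddSubgroup.card_eq_card_quotient_mul_card_addSubgroup mp.ker,
      Nat.card_congr (QuotientAddGroup.quotientKerEquivRange mp).toEquiv, hker_mp,
      Nat.card_congr (AddSubgroup.addSubgroupOfEquivOfLe hAp_le).toEquiv]
  -- `A/pA → B/pB` is onto with kernel the image of `F`
  let ι : F →+ ModN A p := (ModN.mkQ p).comp F.subtype
  have hle : (LinearMap.range (LinearMap.lsmul ℤ A p)).toAddSubgroup ≤
      ((LinearMap.range (LinearMap.lsmul ℤ B p)).toAddSubgroup).comap π := by
    rintro _ ⟨y, rfl⟩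
    exact ⟨π y, by simp only [LinearMap.lsmul_apply, map_zsmul]⟩
  let ρ : ModN A p →+ ModN B p := QuotientAddGroup.map _ _ π hle
  have hρ : ∀ a, ρ (ModN.mkQ p a) = ModN.mkQ p (π a) := fun _ ↦ rfl
  have hρ_surj : Function.Surjective ρ := by
    intro q
    induction q using QuotientAddGroup.induction_on with
    | H b =>
      obtain ⟨a, rfl⟩ := hπs b
      exact ⟨ModN.mkQ p a, hρ a⟩
  have hker_ρ : ρ.ker = ι.range := by
    apply le_antisymm
    · intro q hq
      induction q using QuotientAddGroup.induction_on with
      | H a =>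
        rw [AddMonoidHom.mem_ker] at hq
        change ModN.mkQ p (π a) = 0 at hq
        rw [modN_mkQ_eq_zero_iff] at hq
        obtain ⟨b, hb'⟩ := hq
        obtain ⟨a', rfl⟩ := hπs b
        rw [LinearMap.lsmul_apply, ← map_zsmul] at hb'
        have hmem : -((p : ℤ) • a') + a ∈ F := by
          rw [hFdef, AddMonoidHom.mem_ker, map_add, map_neg, hb', neg_add_cancel]
        have e : (QuotientAddGroup.mk a : ModN A p) =
            ι ⟨-((p : ℤ) • a') + a, hmem⟩ + ModN.mkQ p ((p : ℤ) • a') := by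
          change ModN.mkQ p a = ModN.mkQ p (-((p : ℤ) • a') + a) + ModN.mkQ p ((p : ℤ) • a')
          rw [← map_add]
          congr 1
          abel
        rw [e]
        refine add_mem ⟨_, rfl⟩ ?_
        have h0 : ModN.mkQ p ((p : ℤ) • a') = 0 := by
          rw [modN_mkQ_eq_zero_iff]
          exact ⟨a', rfl⟩
        rw [h0]
        exact zero_mem _
    · rintro _ ⟨f, rfl⟩
      rw [AddMonoidHom.mem_ker]
      change ModN.mkQ p (π (f : A)) = 0
      have hf0 : π (f : A) = 0 := f.2
      rw [hf0, map_zero]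
  have hc1 : Nat.card (ModN A p) = Nat.card (ModN B p) * Nat.card ι.range := by
    rw [AddSubgroup.card_eq_card_quotient_mul_card_addSubgroup ρ.ker,
      Nat.card_congr (QuotientAddGroup.quotientKerEquivOfSurjective ρ hρ_surj).toEquiv, hker_ρ]
  have hc2 : Nat.card F = Nat.card ι.ker * Nat.card ι.range := by
    rw [AddSubgroup.card_eq_card_quotient_mul_card_addSubgroup ι.ker,
      Nat.card_congr (QuotientAddGroup.quotientKerEquivRange ι).toEquiv, mul_comm]
  -- `ker (F → A/pA) = F ∩ pA ⊆ p A_F`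
  have hd : Nat.card ι.ker ≤ Nat.card mp.range := by
    refine Nat.card_le_card_of_injective (fun f : ι.ker ↦ (⟨((f : F) : A), ?_⟩ : mp.range)) ?_
    · have hf : ModN.mkQ p ((f : F) : A) = 0 := f.2
      rw [modN_mkQ_eq_zero_iff] at hf
      obtain ⟨a, ha'⟩ := hf
      rw [LinearMap.lsmul_apply, natCast_zsmul] at ha'
      have haF : a ∈ AF := (hAF a).mpr (by rw [ha']; exact (f : F).2)
      exact ⟨⟨a, haF⟩, ha'⟩
    · intro x y hxy
      exact Subtype.ext (Subtype.ext (by simpa using congrArg Subtype.val hxy))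
  -- combine: `#A[p] · #(B/pB) ≤ #B[p] · #(A/pA)`
  have hFpos : 0 < Nat.card F := Nat.card_pos
  have key : Nat.card A[(p : ℤ)] * Nat.card (ModN B p) ≤
      Nat.card B[(p : ℤ)] * Nat.card (ModN A p) := by
    refine Nat.le_of_mul_le_mul_right ?_ hFpos
    calc Nat.card A[(p : ℤ)] * Nat.card (ModN B p) * Nat.card F
        = Nat.card A[(p : ℤ)] * Nat.card (ModN B p) * (Nat.card ι.ker * Nat.card ι.range) := by
          rw [hc2]
      _ ≤ Nat.card A[(p : ℤ)] * Nat.card (ModN B p) * (Nat.card mp.range * Nat.card ι.range) :=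
          Nat.mul_le_mul_left _ (Nat.mul_le_mul_right _ hd)
      _ = Nat.card mp.range * Nat.card A[(p : ℤ)] * Nat.card (ModN B p) * Nat.card ι.range := by
          ring
      _ = Nat.card B[(p : ℤ)] * Nat.card (ModN A p) * Nat.card F := by
          rw [← hb, ha, hc1]; ring
  letI iA : Module (ZMod p) A[(p : ℤ)] := AddSubgroup.torsionBy.zmodModule
  letI iB : Module (ZMod p) B[(p : ℤ)] := AddSubgroup.torsionBy.zmodModule
  rw [← pow_finrank_eq_natCard (p := p) A[(p : ℤ)], ← pow_finrank_eq_natCard (p := p) (ModN B p),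
    ← pow_finrank_eq_natCard (p := p) B[(p : ℤ)], ← pow_finrank_eq_natCard (p := p) (ModN A p),
    ← pow_add, ← pow_add, Nat.pow_le_pow_iff_right hp.out.one_lt] at key
  show Module.finrank (ZMod p) A[(p : ℤ)] - Module.finrank (ZMod p) (ModN A p) ≤
    Module.finrank (ZMod p) B[(p : ℤ)] - Module.finrank (ZMod p) (ModN B p)
  omega

end Herbrand

section Assembly

variable (p : ℕ) [hp : Fact p.Prime]

/-- **Corank versus rank of a Pontryagin dual.** Let `A` be a `p`-primary abelian group,
`π : A → B` a surjection with finite kernel, and `N` a finitely generated `ℤ_p`-module which is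
isomorphic *as a group* to the character group `Hom(B, ℚ/ℤ)`. Then `zpCorank A p ≤ rank_{ℤ_p} N`:
`corank A ≤ corank B` (`zpCorank_le_of_surjective`) and
`#B[p] = #Hom(B[p], ℚ/ℤ) ≤ #(N/pN) ≤ p^{rank N} · #N[p] = p^{rank N} · #Hom(B, ℚ/ℤ)[p]
≤ p^{rank N} · #Hom(B/pB, ℚ/ℤ) = p^{rank N} · #(B/pB)`. This is the elementary content of
"`corank_{ℤ_p} S = rank_{ℤ_p} Hom(S, ℚ_p/ℤ_p)` for a cofinitely generated `S`"
(Greenberg 1999, §1 p. 60, the Pontryagin dual `X`). [folklore] -/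
theorem zpCorank_le_finrank_of_addEquiv_characterModule
    {A : Type*} [AddCommGroup A] (hA : ∀ a : A, ∃ n : ℕ, p ^ n • a = 0)
    {B : Type*} [AddCommGroup B] (π : A →+ B) (hπs : Function.Surjective π) [Finite π.ker]
    {N : Type*} [AddCommGroup N] [Module ℤ_[p] N] [Module.Finite ℤ_[p] N]
    (Ψ : N ≃+ CharacterModule B) :
    zpCorank A p ≤ Module.finrank ℤ_[p] N := by
  refine (zpCorank_le_of_surjective hA π hπs).trans ?_
  by_cases hfin : Finite B[(p : ℤ)]
  swap
  · rw [zpCorank_eq_zero_of_not_finite hfin]; exact Nat.zero_le _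
  haveI := hfin
  have hB : ∀ b : B, ∃ n : ℕ, p ^ n • b = 0 := primary_of_surjective hA π hπs
  obtain ⟨hBmod, -⟩ := finite_modN_of_primary hB
  haveI := hBmod
  obtain ⟨hNmod, hN⟩ := natCard_modN_le p N
  haveI := hNmod
  haveI : Finite N[(p : ℤ)] := finite_torsionBy p N
  haveI : Finite (ModN (CharacterModule B) p) := Finite.of_equiv _ (modNEquiv Ψ p).toEquiv
  haveI : Finite (CharacterModule (ModN B p)) := finite_characterModule p (ModN B p)
  letI iB : Module (ZMod p) B[(p : ℤ)] := AddSubgroup.torsionBy.zmodModule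
  have h1 : Nat.card B[(p : ℤ)] ≤ Nat.card (ModN N p) := by
    rw [← natCard_characterModule p B[(p : ℤ)], Nat.card_congr (modNEquiv Ψ p).toEquiv]
    exact natCard_characterModule_torsionBy_le p B
  have h2 : Nat.card N[(p : ℤ)] ≤ Nat.card (ModN B p) := by
    rw [Nat.card_congr (torsionByEquiv Ψ p).toEquiv, ← natCard_characterModule p (ModN B p)]
    exact natCard_torsionBy_characterModule_le p B
  have h3 : Nat.card B[(p : ℤ)] ≤ p ^ Module.finrank ℤ_[p] N * Nat.card (ModN B p) :=
    h1.trans (hN.trans (Nat.mul_le_mul_left _ h2))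
  rw [← pow_finrank_eq_natCard (p := p) B[(p : ℤ)], ← pow_finrank_eq_natCard (p := p) (ModN B p),
    ← pow_add, Nat.pow_le_pow_iff_right hp.out.one_lt] at h3
  show Module.finrank (ZMod p) B[(p : ℤ)] - Module.finrank (ZMod p) (ModN B p) ≤ _
  omega

end Assembly

end ZpCorank

end Literature.NumberTheory.EllipticCurves

/-! ## `corank_{ℤ_p} Sel_{p^∞}(E/K) ≤ rank_{ℤ_p} X(E/K_∞)/T X(E/K_∞)` -/

namespace WeierstrassCurve

open Literature.NumberTheory.EllipticCurves Literature.NumberTheory.GaloisRepresentations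
  Literature.NumberTheory.EllipticCurves.ResKernel Literature.NumberTheory.EllipticCurves.IwasawaAlgebra
  Literature.NumberTheory.EllipticCurves.ZpCorank
open scoped Classical AddSubgroup

variable {K : Type u} [Field K] [NumberField K] (W : WeierstrassCurve K) {p : ℕ}
  [Fact p.Prime] {κ : ZpExtension K p} {γ : Field.absoluteGaloisGroup K}

omit [Fact p.Prime] in
/-- Every class of `H¹(K, E[p^∞])` is killed by a power of `p`: `Γ_K` is compact and `E[p^∞]` is
discrete and `p`-primary (a continuous cocycle takes finitely many values). Greenberg (1999), §1
(PDF p. 60, "`Sel_E(F)_p` … a `p`-primary group"); Serre, *Galois Cohomology*, I.§2.2. [folklore] -/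
theorem exists_pow_smul_galH1Primary_eq_zero (c : galH1Primary W p) : ∃ k : ℕ, p ^ k • c = 0 := by
  haveI := compactSpace_absoluteGaloisGroup K
  obtain ⟨φ, rfl⟩ := oneCocycleClass_surjective _ c
  exact IwasawaDual.exists_pow_smul_oneCocycleClass_eq_zero φ fun σ ↦ by
    obtain ⟨k, hk⟩ := (φ.1 σ).2
    exact ⟨k, Subtype.ext (by rw [AddSubgroupClass.coe_nsmul]; exact hk)⟩

/-- **`corank_{ℤ_p} Sel_{p^∞}(E/K) ≤ rank_{ℤ_p} X(E/K_∞)_Γ`** — the inequality half of the corank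
identity `corank_{ℤ_p} Sel_E(K)_p = rank_{ℤ_p} X/TX` (tree fact
`Literature.NumberTheory.EllipticCurves.Greenberg1999_coinvariantsRank_eq_selmerCorank`, Mazur's control
theorem in corank form), **unconditionally**: for an elliptic curve `E/K` over a number field,
*any* `ℤ_p`-extension `K_∞/K` with topological generator `γ` and any Pontryagin-dual datum `D` for
`Sel_{p^∞}(E/K_∞)` with `X = D.X` finitely generated over `Λ`,
`corank_{ℤ_p} Sel_{p^∞}(E/K) ≤ rank_{ℤ_p} X/TX` (`coinvariantsRank`, the `ℤ_p`-structure on `X/TX`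
being the restriction of scalars `Module.compHom` of `coinvariantsRank_eq_finrank_int`). Neither the
local analysis at `p` of the control theorem (Greenberg §3, Lemmas 3.2–3.5) nor the finiteness of
`Ш` enters; the proof is:
(1) *Greenberg's Lemma 3.1* — the restriction `θ : Sel_{p^∞}(E/K) → Sel_{p^∞}(E/K_∞)`
(`resInfty` corestricted by `resInfty_mem_selmerInfty`) has finite kernel, as it embeds in the
kernel of `h_0 : H¹(K, E[p^∞]) → H¹(K_∞, E[p^∞])` (`finite_subgroupResKer_kerSubgroup`);
(2) *restriction of characters* `R₀ : X = Hom(Sel_∞, ℚ/ℤ) → Hom(θ(Sel), ℚ/ℤ)`, `x ↦ (toDual x)|_{θ(Sel)}`,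
kills `TX` because restricted classes are `conj_γ`-invariant (`conjH1_resInfty`, `toDual_T_smul`),
so descends to `R : X/TX → Hom(θ(Sel), ℚ/ℤ)`, whose kernel is a `ℤ_p`-submodule (`toDual_C_smul`) with
`(X/TX)/ker R ≅ Hom(θ(Sel), ℚ/ℤ)` (every character of `θ(Sel) ⊆ Sel_∞` extends, injectivity of `ℚ/ℤ`);
(3) *the corank count* `ZpCorank.zpCorank_le_finrank_of_addEquiv_characterModule` applied to
`θ : Sel ↠ θ(Sel)` (finite kernel, `Sel` is `p`-primary by `exists_pow_smul_galH1Primary_eq_zero`):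
`corank Sel ≤ rank_{ℤ_p} (X/TX)/ker R ≤ rank_{ℤ_p} X/TX`.
Greenberg (1999), §1 p. 65 ("`corank_{ℤ_p}(Sel_E(ℚ)_p)`, which is equal to
`rank_{ℤ_p}(X_E(ℚ_∞)/TX_E(ℚ_∞))`"; Thm 1.2: "the natural maps `Sel_E(F_n)_p → Sel_E(F_∞)_p^{Γ_n}`")
with §3 Lemma 3.1; Mazur (1972), §6. [cite: GreenbergLNM1716, §1 p. 65 and §3 Lemma 3.1] -/
theorem selmerCorank_le_coinvariantsRank [W.IsElliptic] (hγ : κ.IsTopGenerator γ)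
    (D : W.SelmerDualData κ γ) [Module.Finite (IwasawaAlgebra p) D.X] :
    W.selmerCorank p ≤ coinvariantsRank p D.X := by
  letI : Module ℤ_[p] (coinvariants p D.X) :=
    Module.compHom _ (algebraMap ℤ_[p] (IwasawaAlgebra p))
  haveI : Module.Finite ℤ_[p] (coinvariants p D.X) := finite_int_coinvariants p D.X
  -- (1) `θ : Sel_{p^∞}(E/K) → Sel_{p^∞}(E/K_∞)` and its finite kernel
  let θ : W.selmerGroupPInfty p →+ W.selmerInfty κ :=
    ((W.resInfty p κ).comp (W.selmerGroupPInfty p).subtype).codRestrict (W.selmerInfty κ)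
      fun c ↦ W.resInfty_mem_selmerInfty κ c.2
  have hθ : ∀ c : W.selmerGroupPInfty p,
      ((θ c : W.selmerInfty κ) : W.subgroupH1 p κ.kerSubgroup) = W.resInfty p κ c := fun _ ↦ rfl
  haveI : Finite θ.ker := by
    haveI := W.finite_subgroupResKer_kerSubgroup κ hγ (p := p)
    refine Finite.of_injective (fun c : θ.ker ↦
      (⟨((c : W.selmerGroupPInfty p) : galH1Primary W p), ?_⟩ :
        subgroupResKer (geomPrimaryTorsion W p) κ.kerSubgroup)) ?_
    · have hc : θ (c : W.selmerGroupPInfty p) = 0 := c.2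
      rw [mem_subgroupResKer_iff, ← hθ, hc]
      rfl
    · intro a b hab
      exact Subtype.ext (Subtype.ext (by simpa using congrArg Subtype.val hab))
  haveI : Finite θ.rangeRestrict.ker := by
    rw [AddMonoidHom.ker_rangeRestrict]; infer_instance
  -- `Sel_{p^∞}(E/K)` and `θ(Sel)` are `p`-primary
  have hA : ∀ c : W.selmerGroupPInfty p, ∃ k : ℕ, p ^ k • c = 0 := fun c ↦ by
    obtain ⟨k, hk⟩ := W.exists_pow_smul_galH1Primary_eq_zero (c : galH1Primary W p)
    exact ⟨k, Subtype.ext (by rw [AddSubgroupClass.coe_nsmul, hk]; rfl)⟩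
  have hS : ∀ s : θ.range, ∃ k : ℕ, p ^ k • s = 0 := fun s ↦ by
    obtain ⟨k, hk⟩ := W.exists_pow_smul_subgroupH1_ker_eq_zero κ
      ((s : W.selmerInfty κ) : W.subgroupH1 p κ.kerSubgroup)
    refine ⟨k, Subtype.ext (Subtype.ext ?_)⟩
    rw [AddSubgroupClass.coe_nsmul, AddSubgroupClass.coe_nsmul, hk]
    rfl
  -- (2) restriction of characters `R₀ : X → Hom(θ(Sel), ℚ/ℤ)`
  let R₀ : D.X →+ CharacterModule θ.range :=
    { toFun := fun x ↦ (D.toDual x).comp θ.range.subtype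
      map_zero' := by rw [map_zero, AddMonoidHom.zero_comp]; rfl
      map_add' := fun x y ↦ by rw [map_add, AddMonoidHom.add_comp]; rfl }
  have hR₀ : ∀ (x : D.X) (s : θ.range), R₀ x s = D.toDual x (s : W.selmerInfty κ) := fun _ _ ↦ rfl
  -- `R₀` kills `TX`: restricted classes are `conj_γ`-invariant
  have hR₀T : ∀ x : D.X, R₀ ((PowerSeries.X : IwasawaAlgebra p) • x) = 0 := fun x ↦ by
    refine CharacterModule.ext (A := θ.range) fun s ↦ ?_
    obtain ⟨c, hc⟩ := s.2
    rw [hR₀, D.toDual_T_smul]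
    have e : (⟨W.conjH1 p κ.kerSubgroup γ ((s : W.selmerInfty κ) : W.subgroupH1 p κ.kerSubgroup),
        D.conj_mem _ (s : W.selmerInfty κ).2⟩ : W.selmerInfty κ) = (s : W.selmerInfty κ) := by
      apply Subtype.ext
      show W.conjH1 p κ.kerSubgroup γ ((s : W.selmerInfty κ) : W.subgroupH1 p κ.kerSubgroup) = _
      rw [← hc, hθ]
      exact W.conjH1_resInfty κ γ _
    rw [e, sub_self]
    rfl
  -- constants act through `ℤ_p → ℤ/p^k` on `p^k`-torsion classes
  have hR₀C : ∀ (c : ℤ_[p]) (x : D.X) (s : θ.range) (k : ℕ), p ^ k • s = 0 →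
      R₀ (PowerSeries.C c • x) s = (PadicInt.toZModPow k c).val • R₀ x s := by
    intro c x s k hk
    rw [hR₀, hR₀]
    refine D.toDual_C_smul c x _ k ?_
    have h := congrArg (fun t : θ.range ↦ (t : W.selmerInfty κ)) hk
    simpa using h
  -- descend to `R : X/TX → Hom(θ(Sel), ℚ/ℤ)`
  let R : coinvariants p D.X →+ CharacterModule θ.range :=
    QuotientAddGroup.lift
      (Ideal.span {(PowerSeries.X : IwasawaAlgebra p)} •
        (⊤ : Submodule (IwasawaAlgebra p) D.X)).toAddSubgroup R₀ (by
        intro m hm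
        rw [Submodule.mem_toAddSubgroup, Submodule.ideal_span_singleton_smul,
          Submodule.mem_smul_pointwise_iff_exists] at hm
        obtain ⟨z, -, rfl⟩ := hm
        exact hR₀T z)
  have hRmk : ∀ x : D.X, R (Submodule.Quotient.mk x) = R₀ x := fun _ ↦ rfl
  have hRC : ∀ (c : ℤ_[p]) (m : coinvariants p D.X) (s : θ.range) (k : ℕ), p ^ k • s = 0 →
      R (c • m) s = (PadicInt.toZModPow k c).val • R m s := by
    intro c m s k hk
    induction m using Submodule.Quotient.induction_on with
    | H x =>
      have e : c • (Submodule.Quotient.mk x : coinvariants p D.X) =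
          Submodule.Quotient.mk ((PowerSeries.C c : IwasawaAlgebra p) • x) := by
        change (algebraMap ℤ_[p] (IwasawaAlgebra p) c) •
          (Submodule.Quotient.mk x : coinvariants p D.X) = _
        rw [PowerSeries.algebraMap_eq, Submodule.Quotient.mk_smul]
      rw [e, hRmk, hRmk]
      exact hR₀C c x s k hk
  -- `ker R` is a `ℤ_p`-submodule of `X/TX`
  let Kr : Submodule ℤ_[p] (coinvariants p D.X) :=
    { carrier := {m | R m = 0}
      zero_mem' := map_zero R
      add_mem' := fun {a b} ha hb ↦ by
        simp only [Set.mem_setOf_eq] at ha hb ⊢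
        rw [map_add, ha, hb, add_zero]
      smul_mem' := fun c m hm ↦ by
        simp only [Set.mem_setOf_eq] at hm ⊢
        refine CharacterModule.ext (A := θ.range) fun s ↦ ?_
        obtain ⟨k, hk⟩ := hS s
        rw [hRC c m s k hk, hm]
        exact smul_zero _ }
  have hKr : ∀ m, m ∈ Kr ↔ R m = 0 := fun _ ↦ Iff.rfl
  -- `Ψ : (X/TX)/ker R ≅ Hom(θ(Sel), ℚ/ℤ)`
  let Ψ : (coinvariants p D.X ⧸ Kr) →+ CharacterModule θ.range :=
    QuotientAddGroup.lift Kr.toAddSubgroup R (fun _ hm ↦ hm)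
  have hΨ : ∀ m : coinvariants p D.X, Ψ (Submodule.Quotient.mk m) = R m := fun _ ↦ rfl
  have hΨbij : Function.Bijective Ψ := by
    constructor
    · rw [injective_iff_map_eq_zero]
      intro q hq
      induction q using Submodule.Quotient.induction_on with
      | H m =>
        rw [hΨ] at hq
        exact (Submodule.Quotient.mk_eq_zero _).mpr ((hKr m).mpr hq)
    · intro ψ
      obtain ⟨χ, hχ⟩ := CharacterModule.dual_surjective_of_injective
        (θ.range.subtype.toIntLinearMap) (fun a b h ↦ Subtype.ext h) ψ
      obtain ⟨x, rfl⟩ := D.bijective.2 χ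
      refine ⟨Submodule.Quotient.mk (Submodule.Quotient.mk x : coinvariants p D.X), ?_⟩
      rw [hΨ, hRmk, ← hχ]
      rfl
  -- (3) the corank count
  have h := zpCorank_le_finrank_of_addEquiv_characterModule p hA θ.rangeRestrict
    (AddMonoidHom.rangeRestrict_surjective _) (N := coinvariants p D.X ⧸ Kr)
    (AddEquiv.ofBijective Ψ hΨbij)
  calc W.selmerCorank p = zpCorank (W.selmerGroupPInfty p) p := rfl
    _ ≤ Module.finrank ℤ_[p] (coinvariants p D.X ⧸ Kr) := h
    _ ≤ Module.finrank ℤ_[p] (coinvariants p D.X) := Submodule.finrank_quotient_le _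
    _ = coinvariantsRank p D.X := (coinvariantsRank_eq_finrank_int D.X).symm

end WeierstrassCurve

/-! ## Kato's Theorem 18.4 (Selmer form) from Theorem 17.4 alone -/

namespace Literature.NumberTheory.EllipticCurves

open scoped MatrixGroups ModularForm
open CongruenceSubgroup

/-- **Kato Thm 18.4 (Selmer-corank form) from Thm 17.4 WITHOUT Mazur's control theorem**, given
the cyclotomic setting and a finitely generated Iwasawa module. Let `p` be odd and good ordinary
for `E/ℚ` (globally minimal `W`), `f` its newform, `κ` a cyclotomic `ℤ_p`-extension of `ℚ` with
topological generator `γ` matching the cyclotomic variable, `D` Pontryagin-dual data for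
`Sel_{p^∞}(E/ℚ_∞)` with `X = D.X` finitely generated over `Λ`, and assume Kato's divisibility
(`kato_divisibility`: `X` is `Λ`-torsion and `p^n L_p(E,T) = ι g` with `g ∈ char_Λ X`; Kato 2004
Thm 17.4). Then `corank_{ℤ_p} Sel_{p^∞}(E/ℚ) ≤ ord_{T=0} L_p(E,T)`:
`corank Sel ≤ rank_{ℤ_p} X/TX` (`WeierstrassCurve.selmerCorank_le_coinvariantsRank`, this file)
and `rank_{ℤ_p} X/TX ≤ ord g ≤ ord (ι g) = ord (p^n L_p) = ord L_p`
(`Literature.NumberTheory.EllipticCurves.IwasawaAlgebra.coinvariantsRank_le_order_of_mem_charIdeal`).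
Compared with `kato_selmerCorank_le_order_padicLFunction_of_data` (`KatoRankBoundProofs`), the
control-theorem hypothesis `Greenberg1999_coinvariantsRank_eq_selmerCorank_rat` is gone.
[cite: Kato2004, Thm 17.4 (p. 273) and Thm 18.4 (p. 281)] [cite: GreenbergLNM1716, §1 p. 65 and §3 Lemma 3.1] -/
theorem kato_selmerCorank_le_order_padicLFunction_of_data'
    (W : WeierstrassCurve ℚ) [W.IsElliptic] [W.IsGloballyMinimal] (p : ℕ) [Fact p.Prime]
    {N : ℕ} [NeZero N] {f : CuspForm (Gamma0 N) 2}
    {κ : ZpExtension ℚ p} {γ : Field.absoluteGaloisGroup ℚ}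
    (hκ : κ.IsCyclotomic) (hγ : κ.IsTopGenerator γ) (hγ' : IsCyclotomicVariable p γ)
    (D : W.SelmerDualData κ γ) [Module.Finite (IwasawaAlgebra p) D.X]
    (hkato : kato_divisibility W p (κ := κ) (γ := γ) (f := f)) :
    kato_selmerCorank_le_order_padicLFunction W p (f := f) := by
  intro hp hord hf
  obtain ⟨htors, ⟨n, g, hg, hιg⟩, -⟩ := hkato hp hord hκ hγ hγ' hf D
  -- `corank Sel ≤ rank X/TX ≤ ord g`
  have h0 : (W.selmerCorank p : ℕ∞) ≤ (IwasawaAlgebra.coinvariantsRank p D.X : ℕ∞) := by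
    exact_mod_cast W.selmerCorank_le_coinvariantsRank hγ D
  have h1 : (W.selmerCorank p : ℕ∞) ≤ PowerSeries.order g :=
    h0.trans (IwasawaAlgebra.coinvariantsRank_le_order_of_mem_charIdeal D.X htors g hg)
  -- `ord g ≤ ord (ι g)` (coefficientwise `ℤ_p → ℚ_p`)
  have h2 : PowerSeries.order g ≤ PowerSeries.order (iwasawaToPowerSeries p g) :=
    PowerSeries.le_order_map _
  -- `ord (ι g) = ord (p^n L_p) = ord L_p`
  have hpn : IsUnit (PowerSeries.C ((p : ℚ_[p]) ^ n)) := by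
    refine IsUnit.map PowerSeries.C (IsUnit.mk0 _ (pow_ne_zero n ?_))
    exact_mod_cast (Fact.out : p.Prime).ne_zero
  have h3 : PowerSeries.order (iwasawaToPowerSeries p g) =
      PowerSeries.order (padicLFunction f (unitRoot W p : ℚ_[p])) := by
    rw [hιg, PowerSeries.order_mul, PowerSeries.order_zero_of_unit hpn, zero_add]
  exact h3 ▸ h1.trans h2

/-- **Kato Thm 18.4 (Selmer-corank form) from Kato's divisibility (Thm 17.4) alone.** All other
inputs of the reduction are theorems of the tree: the cyclotomic setting
(`exists_isCyclotomic_isTopGenerator_isCyclotomicVariable_holds`), the existence of the Iwasawa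
module (`WeierstrassCurve.nonempty_selmerDualData_holds`), its finite generation over `Λ`
(`WeierstrassCurve.finite_selmerInfty_pTorsion_invariants_holds` with the Nakayama lemma
`SelmerDualData.module_finite_of_finite_pTorsion_invariants`), the corank inequality
`corank Sel_{p^∞}(E/ℚ) ≤ rank_{ℤ_p} X/TX` (`WeierstrassCurve.selmerCorank_le_coinvariantsRank`) and
the structure-theorem inequality (`coinvariantsRank_le_order_of_mem_charIdeal`). The one remaining
named fact behind `kato_selmerCorank_le_order_padicLFunction` is thus `kato_divisibility`
(Kato 2004, Thm 17.4: `X(E/ℚ_∞)` is `Λ`-torsion and `char_Λ X ∣ p^n L_p(E,T)`, the Euler system of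
Beilinson–Kato elements). [cite: Kato2004, Thm 17.4 (p. 273) and Thm 18.4 (p. 281)] -/
theorem kato_selmerCorank_le_order_padicLFunction_of_kato_divisibility
    (W : WeierstrassCurve ℚ) [W.IsElliptic] [W.IsGloballyMinimal] (p : ℕ) [Fact p.Prime]
    {N : ℕ} [NeZero N] {f : CuspForm (Gamma0 N) 2}
    (hkato : ∀ (κ : ZpExtension ℚ p) (γ : Field.absoluteGaloisGroup ℚ),
      kato_divisibility W p (κ := κ) (γ := γ) (f := f)) :
    kato_selmerCorank_le_order_padicLFunction W p (f := f) := by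
  obtain ⟨κ, hκ, γ, hγ, hγ'⟩ := exists_isCyclotomic_isTopGenerator_isCyclotomicVariable_holds p
  obtain ⟨D⟩ := W.nonempty_selmerDualData_holds κ γ hγ
  haveI : Module.Finite (IwasawaAlgebra p) D.X :=
    D.module_finite_of_finite_pTorsion_invariants W
      (W.finite_selmerInfty_pTorsion_invariants_holds κ γ) hκ hγ
  exact kato_selmerCorank_le_order_padicLFunction_of_data' W p hκ hγ hγ' D (hkato κ γ)

/-- **Both forms of Kato Thm 18.4 from Kato's divisibility alone**: the Mordell–Weil-rank form
follows from the Selmer-corank form (this file) and the Kummer corank identity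
`corank Sel_{p^∞}(E/ℚ) = rank E(ℚ) + corank Ш[p^∞]` (tree theorem
`WeierstrassCurve.selmerCorank_eq_mordellWeilRank_add_holds`), exactly as Kato's "In particular"
(Thm 18.4, last sentence). (The tree's `kato_mordellWeilRank_le_order_padicLFunction_of_kato_divisibility`
reaches the same conclusion through `rank E(ℚ) ≤ rank_{ℤ_p} X/TX` directly.)
[cite: Kato2004, Thm 18.4 (p. 281)] -/
theorem kato_rankBounds_of_kato_divisibility
    (W : WeierstrassCurve ℚ) [W.IsElliptic] [W.IsGloballyMinimal] (p : ℕ) [Fact p.Prime]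
    {N : ℕ} [NeZero N] {f : CuspForm (Gamma0 N) 2}
    (hkato : ∀ (κ : ZpExtension ℚ p) (γ : Field.absoluteGaloisGroup ℚ),
      kato_divisibility W p (κ := κ) (γ := γ) (f := f)) :
    kato_selmerCorank_le_order_padicLFunction W p (f := f) ∧
      kato_mordellWeilRank_le_order_padicLFunction W p (f := f) :=
  ⟨kato_selmerCorank_le_order_padicLFunction_of_kato_divisibility W p hkato,
    kato_mordellWeilRank_le_order_padicLFunction_of_selmerCorank W p
      (kato_selmerCorank_le_order_padicLFunction_of_kato_divisibility W p hkato)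
      W.selmerCorank_eq_mordellWeilRank_add_holds⟩

end Literature.NumberTheory.EllipticCurves
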